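import Summits.CriticalPhenomena.PercolationContinuityZ3.Theses.PercLevyKhintchine
import HarnessLib

/-!
# `PercLevyKhintchine.BoundedNegDefPosDef` (stmt-CriticalPhenomena-2168): a bounded negative definite function on `ℤ³`
# is a constant minus a positive definite one

RSW3 lane (lead, gen 31).  CLOSES item `stmt-CriticalPhenomena-2168` of route `CriticalPhenomena/PercLevyKhintchine`
(the assembly's harmonic-analysis glue, no percolation): if `ψ : ℤ³ → ℝ` is even, `ψ(0) = 0`, `ψ ≤ M`, and NEGATIVE
DEFINITE in the group sense (`Σ c_i c_j ψ(x_j − x_i) ≤ 0` whenever `Σ c_i = 0`), then the kernel `M − ψ(x_j − x_i)` is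
positive semi-definite (Berg–Christensen–Ressel 1984, Prop. 4.3.15, there via Schoenberg + Bochner–Herglotz).

ELEMENTARY PROOF BY DOUBLING AND AVERAGING (no Fourier analysis, no Hilbert space).  (i) `ψ ≥ 0` (two-point negative
definiteness, `psi_nonneg`).  (ii) DOUBLING (`two_mul_form_le`): the charge `c` on the points `x_i` together with `−c`
on the translated points `x_i + z` has total mass zero, so negative definiteness and translation invariance give
`2 Q(c) ≤ Σ c_i c_j [ψ(x_j − x_i + z) + ψ(x_j − x_i − z)]` for EVERY `z`, `Q(c) = Σ c_i c_j ψ(x_j − x_i)`.  (iii) AVERAGING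
`z` over the cube `Λ_R` (`sum_box_translate_mem_Icc`, `abs_sum_box_translate_sub_le`): since `0 ≤ ψ ≤ M`, the box sums
`Σ_{z ∈ Λ_R} ψ(v + z)` for `‖v‖∞ ≤ r` all lie between `Σ_{Λ_{R−r}} ψ` and `Σ_{Λ_{R+r}} ψ`, hence within `M(|Λ_{R+r}| − |Λ_{R−r}|)`
of `Σ_{Λ_R} ψ ≤ M |Λ_R|`; so `|Λ_R| Q(c) ≤ M |Λ_R| (Σ c)² + M (|Λ_{R+r}| − |Λ_{R−r}|)(Σ|c_i|)²` (`card_box_mul_form_le`), and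
`(|Λ_{R+r}| − |Λ_{R−r}|)/|Λ_R| = O(r/R) → 0` gives `Q(c) ≤ M (Σ c)²`, i.e. `Σ c_i c_j (M − ψ(x_j − x_i)) ≥ 0`.  Translation
invariance is load-bearing (BCR Remark 3.2.5: false for kernels without group structure) — it enters in step (ii).

Main result: `boundedNegDefPosDef_proof`.  No definitions, no sorries.
References: C. Berg, J. P. R. Christensen, P. Ressel, *Harmonic Analysis on Semigroups* (1984), Prop. 4.3.15 and Remark 3.2.5
[BergChristensenRessel1984].
-/

noncomputable section

namespace Summit.CriticalPhenomena.PercolationContinuityZ3.Theorems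

namespace BoundedNegDefPosDef

open Finset Literature.Probability.LatticeModels

variable {d : ℕ}

/-! ### Step (i): a negative definite function vanishing at `0` is non-negative -/

/-- Two-point negative definiteness: `ψ(v) + ψ(−v) ≥ 0`, so an even negative definite `ψ` with `ψ(0) = 0` is `≥ 0`.
[cite: BergChristensenRessel1984, Ch. 4 §3] -/
theorem psi_nonneg (ψ : Site d → ℝ) (hψ0 : ψ 0 = 0) (heven : ∀ x, ψ (-x) = ψ x)
    (hND : ∀ (n : ℕ) (x : Fin n → Site d) (c : Fin n → ℝ), ∑ i, c i = 0 → ∑ i, ∑ j, c i * c j * ψ (x j - x i) ≤ 0)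
    (v : Site d) : 0 ≤ ψ v := by
  have h := hND 2 ![0, v] ![1, -1] (by simp)
  simp only [Fin.sum_univ_two, Matrix.cons_val_zero, Matrix.cons_val_one] at h
  simp only [sub_zero, zero_sub, sub_self, hψ0, heven] at h
  linarith

/-! ### Step (ii): doubling the configuration -/

/-- **Doubling.**  For every translation `z`: `2 Q(c) ≤ Σ c_i c_j [ψ(x_j − x_i + z) + ψ(x_j − x_i − z)]`, from negative
definiteness of the zero-mass charge `(c on x) − (c on x + z)` and translation invariance. [folklore] -/
theorem two_mul_form_le (ψ : Site d → ℝ)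
    (hND : ∀ (n : ℕ) (x : Fin n → Site d) (c : Fin n → ℝ), ∑ i, c i = 0 → ∑ i, ∑ j, c i * c j * ψ (x j - x i) ≤ 0)
    {n : ℕ} (x : Fin n → Site d) (c : Fin n → ℝ) (z : Site d) :
    2 * ∑ i, ∑ j, c i * c j * ψ (x j - x i) ≤
      ∑ i, ∑ j, c i * c j * (ψ (x j - x i + z) + ψ (x j - x i - z)) := by
  have hsum0 : ∑ i, Fin.append c (fun i => -c i) i = 0 := by
    rw [Fin.sum_univ_add]
    simp only [Fin.append_left, Fin.append_right, Finset.sum_neg_distrib, add_neg_cancel]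
  have h := hND (n + n) (Fin.append x fun i => x i + z) (Fin.append c fun i => -c i) hsum0
  rw [Fin.sum_univ_add] at h
  simp only [Fin.sum_univ_add, Fin.append_left, Fin.append_right, Finset.sum_add_distrib] at h
  have e1 : ∀ i j : Fin n, x j + z - x i = x j - x i + z := fun i j => by abel
  have e2 : ∀ i j : Fin n, x j - (x i + z) = x j - x i - z := fun i j => by abel
  have e3 : ∀ i j : Fin n, x j + z - (x i + z) = x j - x i := fun i j => by abel
  simp only [e1, e2, e3] at h
  have hsplit : ∑ i, ∑ j, c i * c j * (ψ (x j - x i + z) + ψ (x j - x i - z)) =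
      ∑ i, ∑ j, c i * c j * ψ (x j - x i + z) + ∑ i, ∑ j, c i * c j * ψ (x j - x i - z) := by
    rw [← Finset.sum_add_distrib]
    exact Finset.sum_congr rfl fun i _ => by rw [← Finset.sum_add_distrib]; exact Finset.sum_congr rfl fun j _ => by ring
  rw [hsplit]
  have hneg1 : ∑ i, ∑ j, c i * -c j * ψ (x j - x i + z) = -∑ i, ∑ j, c i * c j * ψ (x j - x i + z) := by
    rw [← Finset.sum_neg_distrib]
    exact Finset.sum_congr rfl fun i _ => by rw [← Finset.sum_neg_distrib]; exact Finset.sum_congr rfl fun j _ => by ring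
  have hneg2 : ∑ i, ∑ j, -c i * c j * ψ (x j - x i - z) = -∑ i, ∑ j, c i * c j * ψ (x j - x i - z) := by
    rw [← Finset.sum_neg_distrib]
    exact Finset.sum_congr rfl fun i _ => by rw [← Finset.sum_neg_distrib]; exact Finset.sum_congr rfl fun j _ => by ring
  have hneg3 : ∑ i, ∑ j, -c i * -c j * ψ (x j - x i) = ∑ i, ∑ j, c i * c j * ψ (x j - x i) :=
    Finset.sum_congr rfl fun i _ => Finset.sum_congr rfl fun j _ => by ring
  rw [hneg1, hneg2, hneg3] at h
  linarith

/-! ### Step (iii): averaging over boxes -/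

/-- A translate of a box sits between two boxes: for `‖v‖∞ ≤ r ≤ R`, `Λ_{R−r} ⊆ Λ_R + v ⊆ Λ_{R+r}`, so for `ψ ≥ 0`
the translated box sum is sandwiched: `Σ_{Λ_{R−r}} ψ ≤ Σ_{z ∈ Λ_R} ψ(v + z) ≤ Σ_{Λ_{R+r}} ψ`. [folklore] -/
theorem sum_box_translate_mem_Icc (ψ : Site d → ℝ) (hψ : ∀ w, 0 ≤ ψ w) {r R : ℕ} (hrR : r ≤ R) (v : Site d)
    (hv : ∀ k, |v k| ≤ r) :
    ∑ w ∈ box d (R - r), ψ w ≤ ∑ z ∈ box d R, ψ (v + z) ∧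
      ∑ z ∈ box d R, ψ (v + z) ≤ ∑ w ∈ box d (R + r), ψ w := by
  classical
  have hinj : Set.InjOn (fun z : Site d => v + z) ↑(box d R) := fun a _ b _ h => add_left_cancel h
  have hsum : ∑ z ∈ box d R, ψ (v + z) = ∑ w ∈ (box d R).image (fun z => v + z), ψ w :=
    (Finset.sum_image hinj).symm
  have hsub1 : box d (R - r) ⊆ (box d R).image (fun z => v + z) := by
    intro w hw
    rw [Finset.mem_image]
    refine ⟨w - v, ?_, by abel⟩
    rw [mem_box] at hw ⊢
    intro k
    have h1 := hw k
    have h2 := hv k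
    rw [abs_le] at h2
    rw [Pi.sub_apply]
    push_cast [Nat.cast_sub (R := ℤ) hrR] at h1
    constructor <;> linarith [h1.1, h1.2, h2.1, h2.2]
  have hsub2 : (box d R).image (fun z => v + z) ⊆ box d (R + r) := by
    intro w hw
    rw [Finset.mem_image] at hw
    obtain ⟨z, hz, rfl⟩ := hw
    rw [mem_box] at hz ⊢
    intro k
    have h1 := hz k
    have h2 := hv k
    rw [abs_le] at h2
    rw [Pi.add_apply]
    push_cast
    constructor <;> linarith [h1.1, h1.2, h2.1, h2.2]
  rw [hsum]
  exact ⟨Finset.sum_le_sum_of_subset_of_nonneg hsub1 fun w _ _ => hψ w,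
    Finset.sum_le_sum_of_subset_of_nonneg hsub2 fun w _ _ => hψ w⟩

/-- The mass of `ψ ∈ [0, M]` in the shell `Λ_{R+r} ∖ Λ_{R−r}` is at most `M (|Λ_{R+r}| − |Λ_{R−r}|)`. [folklore] -/
theorem sum_box_sub_sum_box_le (ψ : Site d → ℝ) {M : ℝ} (hM : ∀ w, ψ w ≤ M) (r R : ℕ) :
    ∑ w ∈ box d (R + r), ψ w - ∑ w ∈ box d (R - r), ψ w ≤
      M * (((box d (R + r)).card : ℝ) - (box d (R - r)).card) := by
  have hsub : box d (R - r) ⊆ box d (R + r) := box_mono d (by omega)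
  rw [← Finset.sum_sdiff hsub, add_sub_cancel_right]
  have hcard : (((box d (R + r)) \ box d (R - r)).card : ℝ) = ((box d (R + r)).card : ℝ) - (box d (R - r)).card := by
    rw [Finset.card_sdiff_of_subset hsub, Nat.cast_sub (Finset.card_le_card hsub)]
  calc ∑ w ∈ box d (R + r) \ box d (R - r), ψ w ≤ ∑ _w ∈ box d (R + r) \ box d (R - r), M :=
        Finset.sum_le_sum fun w _ => hM w
    _ = M * (((box d (R + r)).card : ℝ) - (box d (R - r)).card) := by
        rw [Finset.sum_const, nsmul_eq_mul, hcard, mul_comm]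

/-- **Translated box sums are almost translation invariant**: for `0 ≤ ψ ≤ M` and `‖v‖∞ ≤ r ≤ R`,
`|Σ_{z ∈ Λ_R} ψ(v + z) − Σ_{z ∈ Λ_R} ψ(z)| ≤ M (|Λ_{R+r}| − |Λ_{R−r}|)`. [folklore] -/
theorem abs_sum_box_translate_sub_le (ψ : Site d → ℝ) {M : ℝ} (hψ : ∀ w, 0 ≤ ψ w) (hM : ∀ w, ψ w ≤ M) {r R : ℕ}
    (hrR : r ≤ R) (v : Site d) (hv : ∀ k, |v k| ≤ r) :
    |∑ z ∈ box d R, ψ (v + z) - ∑ z ∈ box d R, ψ z| ≤ M * (((box d (R + r)).card : ℝ) - (box d (R - r)).card) := by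
  obtain ⟨h1, h2⟩ := sum_box_translate_mem_Icc ψ hψ hrR v hv
  obtain ⟨h3, h4⟩ := sum_box_translate_mem_Icc ψ hψ hrR (0 : Site d) (fun k => by simp)
  simp only [zero_add] at h3 h4
  have h5 := sum_box_sub_sum_box_le ψ hM r R
  rw [abs_le]
  constructor <;> linarith

/-- Expanding a two-term quadratic form in `c` and `|c|`. [folklore] -/
theorem sum_sum_quad_expand {n : ℕ} (c : Fin n → ℝ) (a b : ℝ) :
    ∑ i, ∑ j, (c i * c j * a + |c i| * |c j| * b) = a * (∑ i, c i) ^ 2 + b * (∑ i, |c i|) ^ 2 := by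
  rw [sq, sq, Finset.sum_mul_sum, Finset.sum_mul_sum, Finset.mul_sum, Finset.mul_sum, ← Finset.sum_add_distrib]
  refine Finset.sum_congr rfl fun i _ => ?_
  rw [Finset.mul_sum, Finset.mul_sum, ← Finset.sum_add_distrib]
  refine Finset.sum_congr rfl fun j _ => ?_
  ring

/-- **The averaged doubling inequality**: with `s = Σ c_i`, `T = Σ |c_i|`, `‖x_j − x_i‖∞ ≤ r ≤ R`, and `0 ≤ ψ ≤ M` negative
definite, `|Λ_R| · Q(c) ≤ M |Λ_R| s² + M (|Λ_{R+r}| − |Λ_{R−r}|) T²`. [folklore] -/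
theorem card_box_mul_form_le (ψ : Site d → ℝ) {M : ℝ} (hψ : ∀ w, 0 ≤ ψ w) (hM : ∀ w, ψ w ≤ M)
    (heven : ∀ x, ψ (-x) = ψ x)
    (hND : ∀ (n : ℕ) (x : Fin n → Site d) (c : Fin n → ℝ), ∑ i, c i = 0 → ∑ i, ∑ j, c i * c j * ψ (x j - x i) ≤ 0)
    {n : ℕ} (x : Fin n → Site d) (c : Fin n → ℝ) {r R : ℕ} (hrR : r ≤ R) (hx : ∀ i j k, |(x j - x i) k| ≤ r) :
    ((box d R).card : ℝ) * ∑ i, ∑ j, c i * c j * ψ (x j - x i) ≤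
      M * (box d R).card * (∑ i, c i) ^ 2 +
        M * (((box d (R + r)).card : ℝ) - (box d (R - r)).card) * (∑ i, |c i|) ^ 2 := by
  set m : ℝ := ((box d R).card : ℝ) with hm
  set D : ℝ := ((box d (R + r)).card : ℝ) - (box d (R - r)).card with hD
  set S0 : ℝ := ∑ z ∈ box d R, ψ z with hS0
  set Q : ℝ := ∑ i, ∑ j, c i * c j * ψ (x j - x i) with hQ
  have hM0 : 0 ≤ M := (hψ 0).trans (hM 0)
  have hD0 : 0 ≤ D := by
    rw [hD, sub_nonneg]
    exact_mod_cast Finset.card_le_card (box_mono d (by omega))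
  -- sum the doubling inequality over `z ∈ Λ_R`
  have hsum : 2 * m * Q ≤ ∑ i, ∑ j, c i * c j *
      (∑ z ∈ box d R, ψ (x j - x i + z) + ∑ z ∈ box d R, ψ (-(x j - x i) + z)) := by
    have h1 : ∑ z ∈ box d R, 2 * Q ≤
        ∑ z ∈ box d R, ∑ i, ∑ j, c i * c j * (ψ (x j - x i + z) + ψ (x j - x i - z)) :=
      Finset.sum_le_sum fun z _ => two_mul_form_le ψ hND x c z
    rw [Finset.sum_const, nsmul_eq_mul] at h1
    have h2 : ∑ z ∈ box d R, ∑ i, ∑ j, c i * c j * (ψ (x j - x i + z) + ψ (x j - x i - z)) =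
        ∑ i, ∑ j, c i * c j * (∑ z ∈ box d R, ψ (x j - x i + z) + ∑ z ∈ box d R, ψ (-(x j - x i) + z)) := by
      rw [Finset.sum_comm]
      refine Finset.sum_congr rfl fun i _ => ?_
      rw [Finset.sum_comm]
      refine Finset.sum_congr rfl fun j _ => ?_
      rw [← Finset.mul_sum, Finset.sum_add_distrib]
      congr 2
      exact Finset.sum_congr rfl fun z _ => by rw [← heven (x j - x i - z), neg_sub, sub_eq_neg_add]
    rw [h2] at h1
    linarith
  -- replace each translated box sum by `S0`, at cost `M D` per unit of `|c_i c_j|`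
  have hpair : ∀ i j, c i * c j * (∑ z ∈ box d R, ψ (x j - x i + z) + ∑ z ∈ box d R, ψ (-(x j - x i) + z)) ≤
      c i * c j * (2 * S0) + |c i| * |c j| * (2 * (M * D)) := by
    intro i j
    have h1 := abs_sum_box_translate_sub_le ψ hψ hM hrR (x j - x i) (hx i j)
    have h2 := abs_sum_box_translate_sub_le ψ hψ hM hrR (-(x j - x i)) (fun k => by
      rw [Pi.neg_apply, abs_neg]; exact hx i j k)
    rw [← hD, ← hS0] at h1 h2
    have key : c i * c j * (∑ z ∈ box d R, ψ (x j - x i + z) + ∑ z ∈ box d R, ψ (-(x j - x i) + z)) -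
        c i * c j * (2 * S0) = (c i * c j) *
          ((∑ z ∈ box d R, ψ (x j - x i + z) - S0) + (∑ z ∈ box d R, ψ (-(x j - x i) + z) - S0)) := by ring
    have h3 : |(c i * c j) * ((∑ z ∈ box d R, ψ (x j - x i + z) - S0) +
        (∑ z ∈ box d R, ψ (-(x j - x i) + z) - S0))| ≤ |c i| * |c j| * (2 * (M * D)) := by
      rw [abs_mul, abs_mul]
      refine mul_le_mul_of_nonneg_left ((abs_add_le _ _).trans (by linarith)) (by positivity)
    have h4 := le_abs_self ((c i * c j) * ((∑ z ∈ box d R, ψ (x j - x i + z) - S0) +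
        (∑ z ∈ box d R, ψ (-(x j - x i) + z) - S0)))
    linarith
  have hS0M : S0 ≤ M * m := by
    calc S0 ≤ ∑ _z ∈ box d R, M := Finset.sum_le_sum fun z _ => hM z
      _ = M * m := by rw [Finset.sum_const, nsmul_eq_mul, hm, mul_comm]
  have hs2 : 0 ≤ (∑ i, c i) ^ 2 := sq_nonneg _
  have hdouble : ∑ i, ∑ j, (c i * c j * (2 * S0) + |c i| * |c j| * (2 * (M * D))) =
      2 * S0 * (∑ i, c i) ^ 2 + 2 * (M * D) * (∑ i, |c i|) ^ 2 := sum_sum_quad_expand c _ _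
  have htot : 2 * m * Q ≤ 2 * S0 * (∑ i, c i) ^ 2 + 2 * (M * D) * (∑ i, |c i|) ^ 2 := by
    rw [← hdouble]
    exact hsum.trans (Finset.sum_le_sum fun i _ => Finset.sum_le_sum fun j _ => hpair i j)
  nlinarith [mul_le_mul_of_nonneg_right hS0M hs2]

/-! ### The limit `R → ∞` on `ℤ³` and the route statement -/

/-- Cube cardinalities on `ℤ³`: `|Λ_{R+r}| − |Λ_{R−r}| ≤ (12 r + 16 r³)(2R+1)²` for `r ≤ R`. [folklore] -/
theorem card_box_three_shell_le {r R : ℕ} (hrR : r ≤ R) :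
    ((box 3 (R + r)).card : ℝ) - (box 3 (R - r)).card ≤ (12 * r + 16 * r ^ 3) * (2 * R + 1) ^ 2 := by
  rw [card_box, card_box]
  push_cast [Nat.cast_sub (R := ℝ) hrR]
  have hr0 : (0 : ℝ) ≤ r := Nat.cast_nonneg _
  have hR0 : (0 : ℝ) ≤ R := Nat.cast_nonneg _
  nlinarith [mul_nonneg (pow_nonneg hr0 3) hR0, mul_nonneg (pow_nonneg hr0 3) (sq_nonneg (R : ℝ))]

/-- **Bounded negative definite functions on `ℤ³`**: `Q(c) = Σ c_i c_j ψ(x_j − x_i) ≤ M (Σ c_i)²` (letting `R → ∞` in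
`card_box_mul_form_le`). [cite: BergChristensenRessel1984, Prop. 4.3.15] -/
theorem form_le_mul_sq (ψ : Site 3 → ℝ) {M : ℝ} (hψ0 : ψ 0 = 0) (heven : ∀ x, ψ (-x) = ψ x) (hM : ∀ w, ψ w ≤ M)
    (hND : ∀ (n : ℕ) (x : Fin n → Site 3) (c : Fin n → ℝ), ∑ i, c i = 0 → ∑ i, ∑ j, c i * c j * ψ (x j - x i) ≤ 0)
    {n : ℕ} (x : Fin n → Site 3) (c : Fin n → ℝ) :
    ∑ i, ∑ j, c i * c j * ψ (x j - x i) ≤ M * (∑ i, c i) ^ 2 := by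
  have hψ : ∀ w, 0 ≤ ψ w := psi_nonneg ψ hψ0 heven hND
  have hM0 : 0 ≤ M := (hψ 0).trans (hM 0)
  -- a common bound `r` on the coordinates of all differences
  set r : ℕ := ∑ i, ∑ k, (x i k).natAbs + ∑ i, ∑ k, (x i k).natAbs with hr
  have hbound : ∀ i k, |x i k| ≤ ∑ i, ∑ k, |x i k| := fun i k =>
    (Finset.single_le_sum (f := fun k => |x i k|) (fun k _ => abs_nonneg _) (mem_univ k)).trans
      (Finset.single_le_sum (f := fun i => ∑ k, |x i k|) (fun i _ => Finset.sum_nonneg fun k _ => abs_nonneg _)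
        (mem_univ i))
  have hx : ∀ i j k, |(x j - x i) k| ≤ r := by
    intro i j k
    rw [hr, Pi.sub_apply]
    push_cast
    calc |x j k - x i k| ≤ |x j k| + |x i k| := abs_sub _ _
      _ ≤ _ := add_le_add (hbound j k) (hbound i k)
  set Q : ℝ := ∑ i, ∑ j, c i * c j * ψ (x j - x i) with hQ
  set s : ℝ := ∑ i, c i with hs
  set T : ℝ := ∑ i, |c i| with hT
  -- for every `R ≥ r`: `(2R+1) (Q − M s²) ≤ M (12 r + 16 r³) T²`
  have hR : ∀ R : ℕ, r ≤ R → (2 * (R : ℝ) + 1) * (Q - M * s ^ 2) ≤ M * (12 * r + 16 * r ^ 3) * T ^ 2 := by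
    intro R hrR
    have h1 := card_box_mul_form_le ψ hψ hM heven hND x c hrR hx
    have h2 := card_box_three_shell_le hrR
    rw [← hQ, ← hs, ← hT] at h1
    have hm : ((box 3 R).card : ℝ) = (2 * R + 1) ^ 3 := by rw [card_box]; push_cast; ring
    rw [hm] at h1
    have hpos : (0 : ℝ) < (2 * R + 1) ^ 2 := by positivity
    have h3 : (2 * (R : ℝ) + 1) ^ 3 * (Q - M * s ^ 2) ≤ M * ((12 * r + 16 * r ^ 3) * (2 * R + 1) ^ 2) * T ^ 2 := by
      have hT2 : 0 ≤ M * T ^ 2 := by positivity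
      nlinarith [mul_le_mul_of_nonneg_left h2 hT2]
    have h4 : (2 * (R : ℝ) + 1) ^ 3 * (Q - M * s ^ 2) = (2 * R + 1) ^ 2 * ((2 * R + 1) * (Q - M * s ^ 2)) := by ring
    rw [h4] at h3
    have h5 : M * ((12 * r + 16 * r ^ 3) * (2 * (R : ℝ) + 1) ^ 2) * T ^ 2 =
        (2 * R + 1) ^ 2 * (M * (12 * r + 16 * r ^ 3) * T ^ 2) := by ring
    rw [h5] at h3
    exact le_of_mul_le_mul_left h3 hpos
  -- let `R → ∞`
  by_contra hcon
  push Not at hcon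
  have hgap : 0 < Q - M * s ^ 2 := by linarith
  obtain ⟨R, hRbig⟩ := exists_nat_gt ((M * (12 * r + 16 * r ^ 3) * T ^ 2) / (Q - M * s ^ 2) + r)
  have hrR : r ≤ R := by
    have : (r : ℝ) < R := by
      have h0 : 0 ≤ (M * (12 * r + 16 * r ^ 3) * T ^ 2) / (Q - M * s ^ 2) := by positivity
      linarith
    exact_mod_cast this.le
  have h1 := hR R hrR
  have h2 : (M * (12 * r + 16 * r ^ 3) * T ^ 2) / (Q - M * s ^ 2) < 2 * (R : ℝ) + 1 := by
    have : (0 : ℝ) ≤ r := Nat.cast_nonneg r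
    linarith
  rw [div_lt_iff₀ hgap] at h2
  linarith

/-- **`PercLevyKhintchine.BoundedNegDefPosDef` (stmt-CriticalPhenomena-2168).**  A real, even function `ψ` on `ℤ³`
with `ψ(0) = 0`, `ψ ≤ M`, negative definite in the group sense (`Σ c_i c_j ψ(x_j − x_i) ≤ 0` when `Σ c_i = 0`), has
`(M − ψ(x_j − x_i))_{ij}` positive semi-definite — proved by doubling the configuration and averaging over cubes,
without Bochner–Herglotz. [cite: BergChristensenRessel1984, Prop. 4.3.15] -/
theorem boundedNegDefPosDef_proof :
    Summit.CriticalPhenomena.PercolationContinuityZ3.Theses.PercLevyKhintchine.BoundedNegDefPosDef := by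
  intro ψ M hψ0 heven hM hND n x c
  have h := form_le_mul_sq ψ hψ0 heven hM hND x c
  have hexp : ∑ i, ∑ j, c i * c j * (M - ψ (x j - x i)) =
      M * (∑ i, c i) ^ 2 - ∑ i, ∑ j, c i * c j * ψ (x j - x i) := by
    rw [sq, Finset.sum_mul_sum, Finset.mul_sum, ← Finset.sum_sub_distrib]
    refine Finset.sum_congr rfl fun i _ => ?_
    rw [Finset.mul_sum, ← Finset.sum_sub_distrib]
    refine Finset.sum_congr rfl fun j _ => ?_
    ring
  rw [hexp]
  linarith

end BoundedNegDefPosDef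

end Summit.CriticalPhenomena.PercolationContinuityZ3.Theorems

end
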